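import Summits.CriticalPhenomena.Ising3DConformalLimit.Theorems.LinkingParityCirclesSpinRatioMoebiusStubRatioLimitOfScalingLimit
import Summits.CriticalPhenomena.Ising3DConformalLimit.Theorems.LinkingParityCirclesSpinRatioMoebiusStubProdPairsLe
import HarnessLib

/-!
# Crux `LinkingParityCircles.SpinRatioMoebius` (stmt-CriticalPhenomena-4530), line `registered` —
# stub `stub_telescopingLimitOfScalingLimit`: the TELESCOPING RATIO LIMITS from any pointwise scaling limit

Route `CurrentConnectionInvariance` (item `RatioLimit`) studies the telescoping ratios of RAW critical `ℤ³`
Ising correlators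
`R_n(δ, z) = ⟨∏_{i<n} σ_{[zᵢ/δ]}⟩ ⟨σ_{[z_n/δ]}σ_{[z_{n+1}/δ]}⟩ / ⟨∏_{i<n+2} σ_{[zᵢ/δ]}⟩` (`n` even).
If the correlators have a pointwise scaling limit `S` under SOME renormalisation `ρ` (positive on `(0,1]`) with
`S₂ > 0` off the diagonal, then `R_n(δ, ·) → p := S_n(z|ₙ) S_2(z_n, z_{n+1}) / S_{n+2}(z)` locally uniformly on
the non-coincident locus, and `p` is continuous and positive there.

Proof.
* Even levels of `S` are positive on the locus: at injective lattice images iterated GKS II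
  (`stub_prodPairsLe`) gives `∏_j ρ²⟨σσ⟩ ≤ ρ^{2m}⟨∏σ⟩`; the left side converges to `∏_j S_2(pairs) > 0`
  (`tendsto_prodPairFactor_of_scalingLimit`, non-degeneracy), the right side to `S_{2m}` — so `S_{2m} > 0`
  (`le_of_tendsto_of_tendsto`).
* Every `S_k` is continuous on the locus (mesh continuity, `LimitMeshContinuity.continuousOn_limit`), and the
  restrictions `z ↦ z|ₙ`, `z ↦ (z_n, z_{n+1})` are continuous maps of loci; hence `p` is continuous and positive.
* `ρⁿ⟨∏_{i<n}σ⟩ · ρ²⟨σσ⟩ / (ρ^{n+2}⟨∏_{i<n+2}σ⟩) → p` locally uniformly (`TendstoLocallyUniformlyOn.comp/.mul₀/.div₀`),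
  and for `δ ∈ (0,1]` (`ρ δ ≠ 0`) the powers of `ρ` cancel, leaving exactly `R_n(δ, z)`.

References: S. Friedli, Y. Velenik (CUP 2017) Thm. 3.20 (GKS); H. Duminil-Copin (2019) Thm. 4.8.
-/

noncomputable section

namespace Summit.CriticalPhenomena.Ising3DConformalLimit.Cruxes.SpinRatioMoebius.Birth

open Literature.Probability.LatticeModels Filter Set Metric
open Summit.CriticalPhenomena.Ising3DConformalLimit.Cruxes.IsingEuclidUpgradeR4NonGaussian.FreeCovarianceDeltaDichotomy
  (criticalCorr_two_pos')
open Summit.CriticalPhenomena.Ising3DConformalLimit.LimitMeshContinuity (continuousOn_limit)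
open scoped Topology

namespace Telescoping

/-! ## §A Even levels of a non-degenerate pointwise scaling limit are positive on the locus -/

/-- Eventually (as `δ → 0⁺`, once the lattice images are injective) the rescaled correlator at an even level
dominates the product of its rescaled pair factors: `∏_j ρ²⟨σσ⟩ ≤ ρ^{2m}⟨∏σ⟩` (iterated GKS II). [folklore] -/
theorem eventually_prodPairFactor_le_rescaled (ρ : ℝ → ℝ) (m : ℕ) {x : Fin (m + m) → EuclideanSpace ℝ (Fin 3)}
    (hx : x ∈ NonCoincident 3 (m + m)) :
    ∀ᶠ δ in 𝓝[>] (0:ℝ),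
      (∏ j : Fin m, (ρ δ ^ 2 *
          criticalCorr 3 2 ![latticeApprox δ (x (Fin.castAdd m j)), latticeApprox δ (x (Fin.natAdd m j))])) ≤
        rescaledCorrelator (criticalCorr 3) ρ (m + m) δ x := by
  filter_upwards [eventually_injective_latticeApprox hx] with δ hδ
  rw [rescaled_even_factorisation ρ m δ x]
  have hP : 0 < ∏ j : Fin m,
      criticalCorr 3 2 ![latticeApprox δ (x (Fin.castAdd m j)), latticeApprox δ (x (Fin.natAdd m j))] :=
    Finset.prod_pos fun j _ => criticalCorr_two_pos' _ _
  have hQ : 1 ≤ criticalCorr 3 (m + m) (fun i => latticeApprox δ (x i)) /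
      ∏ j : Fin m, criticalCorr 3 2 ![latticeApprox δ (x (Fin.castAdd m j)), latticeApprox δ (x (Fin.natAdd m j))] := by
    rw [le_div_iff₀ hP, one_mul]
    exact stub_prodPairsLe m (fun i => latticeApprox δ (x i)) hδ
  have hnn : 0 ≤ ∏ j : Fin m, (ρ δ ^ 2 *
      criticalCorr 3 2 ![latticeApprox δ (x (Fin.castAdd m j)), latticeApprox δ (x (Fin.natAdd m j))]) :=
    Finset.prod_nonneg fun j _ => mul_nonneg (sq_nonneg _) (criticalCorr_two_pos' _ _).le
  exact le_mul_of_one_le_left hnn hQ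

/-- **Even levels of a non-degenerate pointwise scaling limit of the critical `ℤ³` correlators are positive on the
locus**: `0 < ∏_j S_2(x_j, x_{m+j}) ≤ S_{m+m}(x)`. [folklore] -/
theorem limit_pos_of_even {ρ : ℝ → ℝ} {S : CorrFamily 3}
    (hlim : HasPointwiseScalingLimit (criticalCorr 3) ρ S) (hnd : IsNondegenerateTwoPoint S) :
    ∀ {k : ℕ}, Even k → ∀ x ∈ NonCoincident 3 k, 0 < S k x := by
  intro k hk x hx
  obtain ⟨m, rfl⟩ := hk
  have h1 := (hlim (m + m)).tendsto_at hx
  have h2 := (tendsto_prodPairFactor_of_scalingLimit hlim m).tendsto_at hx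
  have hle := le_of_tendsto_of_tendsto h2 h1 (eventually_prodPairFactor_le_rescaled ρ m hx)
  exact lt_of_lt_of_le (Finset.prod_pos fun j _ => hnd _ (pairProj_mapsTo m j hx)) hle

/-! ## §B The two restriction maps `z ↦ z|ₙ` and `z ↦ (z_n, z_{n+1})` -/

/-- Restriction to the first `n` points maps the locus into the locus. [folklore] -/
theorem head_mapsTo (n : ℕ) :
    MapsTo (fun (z : Fin (n + 2) → EuclideanSpace ℝ (Fin 3)) (i : Fin n) => z (Fin.castAdd 2 i))
      (NonCoincident 3 (n + 2)) (NonCoincident 3 n) := fun z hz =>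
  (mem_nonCoincident _).2 (((mem_nonCoincident z).1 hz).comp (Fin.castAdd_injective _ _))

/-- Restriction to the first `n` points is continuous. [folklore] -/
theorem continuous_head (n : ℕ) :
    Continuous fun (z : Fin (n + 2) → EuclideanSpace ℝ (Fin 3)) (i : Fin n) => z (Fin.castAdd 2 i) :=
  continuous_pi fun _ => continuous_apply _

/-- Restriction to the last two points maps the locus into the two-point locus. [folklore] -/
theorem tail_mapsTo (n : ℕ) :
    MapsTo (fun (z : Fin (n + 2) → EuclideanSpace ℝ (Fin 3)) (i : Fin 2) => z (Fin.natAdd n i))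
      (NonCoincident 3 (n + 2)) (NonCoincident 3 2) := fun z hz =>
  (mem_nonCoincident _).2 (((mem_nonCoincident z).1 hz).comp (Fin.natAdd_injective _ _))

/-- Restriction to the last two points is continuous. [folklore] -/
theorem continuous_tail (n : ℕ) :
    Continuous fun (z : Fin (n + 2) → EuclideanSpace ℝ (Fin 3)) (i : Fin 2) => z (Fin.natAdd n i) :=
  continuous_pi fun _ => continuous_apply _

/-! ## §C The renormalisation cancels in the telescoping ratio -/

/-- `rᵏ a · (r² b) / (r^{k+2} c) = a b / c` for `r ≠ 0`. [folklore] -/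
theorem ratio_cancel {r : ℝ} (hr : r ≠ 0) (k : ℕ) (a b c : ℝ) :
    r ^ k * a * (r ^ 2 * b) / (r ^ (k + 2) * c) = a * b / c := by
  rw [show r ^ k * a * (r ^ 2 * b) = r ^ (k + 2) * (a * b) by rw [pow_add]; ring]
  exact mul_div_mul_left _ _ (pow_ne_zero _ hr)

end Telescoping

/-! ## §D The stub -/

/-- **Stub `stub_telescopingLimitOfScalingLimit` (telescoping ratio limits from ANY non-degenerate pointwise
scaling limit).** For even `n`, the raw telescoping ratio
`⟨∏_{i<n}σ_{[zᵢ/δ]}⟩⟨σ_{[z_n/δ]}σ_{[z_{n+1}/δ]}⟩ / ⟨∏_{i<n+2}σ_{[zᵢ/δ]}⟩` converges locally uniformly on the locus to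
`S_n(z|ₙ) S_2(z_n,z_{n+1}) / S_{n+2}(z)`, which is continuous and positive there. [folklore] -/
theorem stub_telescopingLimitOfScalingLimit : ∀ (ρ : ℝ → ℝ) (S : Literature.Probability.LatticeModels.CorrFamily 3), (∀ δ ∈ Set.Ioc (0:ℝ) 1, 0 < ρ δ) → Literature.Probability.LatticeModels.HasPointwiseScalingLimit (Literature.Probability.LatticeModels.criticalCorr 3) ρ S → Literature.Probability.LatticeModels.IsNondegenerateTwoPoint S → ∀ n : ℕ, Even n → ContinuousOn (fun z : Fin (n + 2) → EuclideanSpace ℝ (Fin 3) => S n (fun i => z (Fin.castAdd 2 i)) * S 2 (fun i => z (Fin.natAdd n i)) / S (n + 2) z) (Literature.Probability.LatticeModels.NonCoincident 3 (n + 2)) ∧ (∀ z ∈ Literature.Probability.LatticeModels.NonCoincident 3 (n + 2), 0 < S n (fun i => z (Fin.castAdd 2 i)) * S 2 (fun i => z (Fin.natAdd n i)) / S (n + 2) z) ∧ TendstoLocallyUniformlyOn (fun (δ : ℝ) (z : Fin (n + 2) → EuclideanSpace ℝ (Fin 3)) => Literature.Probability.LatticeModels.rescaledCorrelator (Literature.Probability.LatticeModels.criticalCorr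 3) 1 n δ (fun i => z (Fin.castAdd 2 i)) * Literature.Probability.LatticeModels.rescaledCorrelator (Literature.Probability.LatticeModels.criticalCorr 3) 1 2 δ (fun i => z (Fin.natAdd n i)) / Literature.Probability.LatticeModels.rescaledCorrelator (Literature.Probability.LatticeModels.criticalCorr 3) 1 (n + 2) δ z) (fun z => S n (fun i => z (Fin.castAdd 2 i)) * S 2 (fun i => z (Fin.natAdd n i)) / S (n + 2) z) (nhdsWithin 0 (Set.Ioi 0)) (Literature.Probability.LatticeModels.NonCoincident 3 (n + 2)) := by
  intro ρ S hρ hlim hnd n hn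
  -- continuity and positivity of the three limit factors on the locus
  have hcA : ContinuousOn (fun z : Fin (n + 2) → EuclideanSpace ℝ (Fin 3) => S n (fun i => z (Fin.castAdd 2 i)))
      (NonCoincident 3 (n + 2)) :=
    (continuousOn_limit hlim n).comp (Telescoping.continuous_head n).continuousOn (Telescoping.head_mapsTo n)
  have hcB : ContinuousOn (fun z : Fin (n + 2) → EuclideanSpace ℝ (Fin 3) => S 2 (fun i => z (Fin.natAdd n i)))
      (NonCoincident 3 (n + 2)) :=
    (continuousOn_limit hlim 2).comp (Telescoping.continuous_tail n).continuousOn (Telescoping.tail_mapsTo n)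
  have hcC : ContinuousOn (S (n + 2)) (NonCoincident 3 (n + 2)) := continuousOn_limit hlim (n + 2)
  have hA0 : ∀ z ∈ NonCoincident 3 (n + 2), 0 < S n (fun i => z (Fin.castAdd 2 i)) :=
    fun z hz => Telescoping.limit_pos_of_even hlim hnd hn _ (Telescoping.head_mapsTo n hz)
  have hB0 : ∀ z ∈ NonCoincident 3 (n + 2), 0 < S 2 (fun i => z (Fin.natAdd n i)) :=
    fun z hz => hnd _ (Telescoping.tail_mapsTo n hz)
  have hn2 : Even (n + 2) := hn.add even_two
  have hC0 : ∀ z ∈ NonCoincident 3 (n + 2), 0 < S (n + 2) z :=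
    fun z hz => Telescoping.limit_pos_of_even hlim hnd hn2 z hz
  have hCne : ∀ z ∈ NonCoincident 3 (n + 2), S (n + 2) z ≠ 0 := fun z hz => (hC0 z hz).ne'
  refine ⟨(hcA.mul hcB).div hcC hCne, fun z hz => div_pos (mul_pos (hA0 z hz) (hB0 z hz)) (hC0 z hz), ?_⟩
  -- convergence of the renormalised telescoping ratio
  have hA := (hlim n).comp _ (Telescoping.head_mapsTo n) (Telescoping.continuous_head n).continuousOn
  have hB := (hlim 2).comp _ (Telescoping.tail_mapsTo n) (Telescoping.continuous_tail n).continuousOn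
  have hABC := (hA.mul₀ hB hcA hcB).div₀ (hlim (n + 2)) (hcA.mul hcB) hcC hCne
  -- for `δ ∈ (0, 1]` the powers of `ρ δ ≠ 0` cancel, leaving the raw ratio
  refine TendstoLocallyUniformlyOn.congr_eventually hABC ?_
  filter_upwards [Ioc_mem_nhdsGT (zero_lt_one' ℝ)] with δ hδ z _
  simp only [Pi.div_apply, Pi.mul_apply, Function.comp_apply, rescaledCorrelator_apply, Pi.one_apply, one_pow,
    one_mul]
  exact Telescoping.ratio_cancel (hρ δ hδ).ne' n _ _ _

end Summit.CriticalPhenomena.Ising3DConformalLimit.Cruxes.SpinRatioMoebius.Birth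

end
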